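import Literature.NumberTheory.Sieve.EulerMascheroniEin
import Literature.Analysis.SpecialFunctions.FrullaniExp
import Mathlib.MeasureTheory.Integral.IntegralEqImproper
import Mathlib.Analysis.Complex.ExponentialBounds
import Mathlib.Analysis.SpecialFunctions.Trigonometric.DerivHyp
import HarnessLib

/-!
# `∫₀^∞ (1/sinh t − e^{−βt}/t) dt = γ + log 2 + log β`

The constant in Weil's evaluation of the finite part `PF ∫ F(x) K_{1,a}(x) dx` of the explicit
formula against the digamma form of the archimedean term (A. Weil, *Sur les "formules explicites"
de la théorie des nombres premiers*, Comm. Sém. Math. Univ. Lund 1952, pp. 258–261, (5), (10)):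
comparing Bombieri's regularisation `(e^{(1/2−a)x}k(x) − k(0))/(2 sinh x)` of the position-space
archimedean term with Weil's `λ`-regularisation (counterterm `k(0) e^{−(a+1/2)x}/x`) leaves the
absolutely convergent integral `∫₀^∞ (1/sinh t − e^{−βt}/t) dt`, `β = a + 1/2`, which this file
evaluates:

* `integral_inv_sinh_sub_exp_neg_div` : `∫₀^∞ (1/sinh t − e^{−t}/t) dt = γ + log 2`, from the
  antiderivative `log((eᵗ − 1)/(eᵗ + 1)) + E₁(t)` and `E₁ = Ein − γ − log` (the tree's
  `Literature.NumberTheory.Sieve.ein_eq_add`, Euler's integral for `γ`);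
* `integral_inv_sinh_sub_exp_neg_mul_div` : the general `β > 0` by the exponential Frullani
  integral (`Literature.Analysis.SpecialFunctions.integral_frullani_exp`).

## References

* A. Weil, *Sur les "formules explicites" de la théorie des nombres premiers*, Comm. Sém. Math.
  Univ. Lund (1952), 252–265, pp. 258–261. [Weil1952FormulesExplicites]
-/

noncomputable section

open Real Filter Set MeasureTheory Topology

namespace Literature.Analysis.SpecialFunctions

open Literature.NumberTheory.Sieve

/-! ### The integrand `1/sinh t − e^{−βt}/t` -/

/-- `e^{−t} sinh t = (1 − e^{−2t})/2`. [folklore] -/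
private theorem exp_neg_mul_sinh (t : ℝ) : Real.exp (-t) * Real.sinh t = (1 - Real.exp (-(2 * t))) / 2 := by
  rw [Real.sinh_eq]
  have h1 : Real.exp (-t) * Real.exp t = 1 := by rw [← Real.exp_add]; simp
  have h2 : Real.exp (-t) * Real.exp (-t) = Real.exp (-(2 * t)) := by rw [← Real.exp_add]; ring_nf
  nlinarith [h1, h2]

/-- **`|1/sinh t − e^{−t}/t| ≤ 12 e^{−t}`** for `t > 0` (bounded near `0` by the second-order
cancellation `t − e^{−t} sinh t = O(t²)`, exponentially small at infinity). [folklore] -/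
private theorem abs_inv_sinh_sub_le {t : ℝ} (ht : 0 < t) :
    |1 / Real.sinh t - Real.exp (-t) / t| ≤ 12 * Real.exp (-1 * t) := by
  rw [neg_one_mul]
  have hsinh : 0 < Real.sinh t := Real.sinh_pos_iff.2 ht
  have hts : t ≤ Real.sinh t := Real.self_le_sinh_iff.2 ht.le
  have he1 : Real.exp 1 < 3 := lt_trans Real.exp_one_lt_d9 (by norm_num)
  rcases le_or_gt t (1 / 2) with h | h
  · -- near zero
    have hrew : 1 / Real.sinh t - Real.exp (-t) / t =
        (t - Real.exp (-t) * Real.sinh t) / (t * Real.sinh t) := by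
      field_simp
    rw [hrew, exp_neg_mul_sinh, abs_div, abs_of_pos (by positivity : 0 < t * Real.sinh t)]
    have hnum : |t - (1 - Real.exp (-(2 * t))) / 2| ≤ 2 * t ^ 2 := by
      have h0 : |Real.exp (-(2 * t)) - 1 - -(2 * t)| ≤ (-(2 * t)) ^ 2 :=
        Real.abs_exp_sub_one_sub_id_le (by rw [abs_neg, abs_of_nonneg (by linarith)]; linarith)
      rw [show t - (1 - Real.exp (-(2 * t))) / 2 = (Real.exp (-(2 * t)) - 1 - -(2 * t)) / 2 by ring,
        abs_div, abs_two]
      nlinarith [h0]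
    have hden : t ^ 2 ≤ t * Real.sinh t := by nlinarith
    have hexp : 1 / 2 ≤ Real.exp (-t) := by
      have : Real.exp t ≤ Real.exp (1 / 2) := Real.exp_le_exp.2 h
      have h2 : Real.exp (1 / 2) ≤ 2 := by
        have hsq : Real.exp (1 / 2) ^ 2 = Real.exp 1 := by rw [← Real.exp_nat_mul]; norm_num
        nlinarith [Real.exp_pos (1 / 2 : ℝ)]
      rw [Real.exp_neg]
      rw [le_inv_comm₀ (by norm_num) (Real.exp_pos t)]
      linarith
    calc |t - (1 - Real.exp (-(2 * t))) / 2| / (t * Real.sinh t) ≤ (2 * t ^ 2) / (t ^ 2) :=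
          div_le_div₀ (by positivity) hnum (by positivity) hden
      _ = 2 := by field_simp
      _ ≤ 12 * Real.exp (-t) := by linarith
  · -- away from zero
    have het : 3 / 2 ≤ Real.exp t := by linarith [Real.add_one_le_exp t]
    have hem : Real.exp (-t) ≤ 1 := Real.exp_le_one_iff.2 (by linarith)
    have hsinh6 : Real.exp t / 6 ≤ Real.sinh t := by rw [Real.sinh_eq]; linarith
    have hprod : Real.exp t * Real.exp (-t) = 1 := by rw [← Real.exp_add]; simp
    have h1 : |1 / Real.sinh t| ≤ 6 * Real.exp (-t) := by
      rw [abs_of_pos (by positivity), div_le_iff₀ hsinh]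
      nlinarith [Real.exp_pos (-t)]
    have h2 : |Real.exp (-t) / t| ≤ 2 * Real.exp (-t) := by
      rw [abs_of_pos (by positivity), div_le_iff₀ ht]
      nlinarith [Real.exp_pos (-t)]
    calc |1 / Real.sinh t - Real.exp (-t) / t| ≤ |1 / Real.sinh t| + |Real.exp (-t) / t| := abs_sub _ _
      _ ≤ 12 * Real.exp (-t) := by nlinarith [Real.exp_pos (-t)]

/-- `t ↦ 1/sinh t − e^{−t}/t` is continuous on `(0, ∞)`. [folklore] -/
private theorem continuousOn_inv_sinh_sub :
    ContinuousOn (fun t : ℝ ↦ 1 / Real.sinh t - Real.exp (-t) / t) (Ioi 0) := by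
  refine ContinuousOn.sub ?_ ?_
  · exact continuousOn_const.div Real.continuous_sinh.continuousOn
      fun t (ht : 0 < t) ↦ (Real.sinh_pos_iff.2 ht).ne'
  · exact (Real.continuous_exp.comp continuous_neg).continuousOn.div continuousOn_id
      fun t (ht : 0 < t) ↦ ht.ne'

/-- **Integrability**: `1/sinh t − e^{−t}/t` is integrable on `(0, ∞)`.
[cite: Weil1952FormulesExplicites, pp. 260–261 (the PF against K_{1,f} is a convergent integral)] -/
theorem integrableOn_inv_sinh_sub_exp_neg_div :
    IntegrableOn (fun t : ℝ ↦ 1 / Real.sinh t - Real.exp (-t) / t) (Ioi 0) := by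
  refine Integrable.mono' ((exp_neg_integrableOn_Ioi 0 one_pos).const_mul 12)
    (continuousOn_inv_sinh_sub.aestronglyMeasurable measurableSet_Ioi) ?_
  refine (ae_restrict_iff' measurableSet_Ioi).2 (Eventually.of_forall fun t (ht : 0 < t) ↦ ?_)
  rw [Real.norm_eq_abs]
  exact abs_inv_sinh_sub_le ht

/-! ### The antiderivative `log((eᵗ − 1)/(eᵗ + 1)) + E₁(t)` -/

/-- For `t > 0`: `d/dt [log(eᵗ − 1) − log(eᵗ + 1) + E₁(t)] = 1/sinh t − e^{−t}/t`. [folklore] -/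
private theorem hasDerivAt_antideriv {t : ℝ} (ht : 0 < t) :
    HasDerivAt (fun u : ℝ ↦ Real.log (Real.exp u - 1) - Real.log (Real.exp u + 1) + expIntegralE1 u)
      (1 / Real.sinh t - Real.exp (-t) / t) t := by
  have he1 : Real.exp t - 1 ≠ 0 := by
    have : 1 < Real.exp t := Real.one_lt_exp_iff.2 ht
    linarith
  have he2 : Real.exp t + 1 ≠ 0 := by positivity
  have h1 : HasDerivAt (fun u : ℝ ↦ Real.log (Real.exp u - 1)) (Real.exp t / (Real.exp t - 1)) t := by
    have := ((Real.hasDerivAt_exp t).sub_const 1).log he1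
    simpa using this
  have h2 : HasDerivAt (fun u : ℝ ↦ Real.log (Real.exp u + 1)) (Real.exp t / (Real.exp t + 1)) t := by
    have := ((Real.hasDerivAt_exp t).add_const 1).log he2
    simpa using this
  have h3 := hasDerivAt_expIntegralE1 ht
  refine ((h1.sub h2).add h3).congr_deriv ?_
  have hprod : Real.exp t * Real.exp (-t) = 1 := by rw [← Real.exp_add]; simp
  have hd : Real.exp t - Real.exp (-t) ≠ 0 := by
    have : Real.exp (-t) < Real.exp t := Real.exp_lt_exp.2 (by linarith)
    linarith
  have key : Real.exp t / (Real.exp t - 1) - Real.exp t / (Real.exp t + 1) = 1 / Real.sinh t := by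
    rw [div_sub_div _ _ he1 he2, Real.sinh_eq, one_div_div, div_eq_div_iff (mul_ne_zero he1 he2) hd]
    linear_combination (-2 : ℝ) * hprod
  rw [← key]
  ring

/-- The antiderivative tends to `0` at `+∞`. [folklore] -/
private theorem tendsto_antideriv_atTop :
    Tendsto (fun u : ℝ ↦ Real.log (Real.exp u - 1) - Real.log (Real.exp u + 1) + expIntegralE1 u)
      atTop (𝓝 0) := by
  -- `log(eᵘ − 1) − log(eᵘ + 1) = log(1 − 2/(eᵘ + 1)) → log 1 = 0`
  have hq : Tendsto (fun u : ℝ ↦ 1 - 2 / (Real.exp u + 1)) atTop (𝓝 (1 - 0)) := by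
    refine tendsto_const_nhds.sub ?_
    have h := Real.tendsto_exp_atTop.atTop_add tendsto_const_nhds (C := (1 : ℝ))
    exact h.const_div_atTop 2
  rw [sub_zero] at hq
  have hlog : Tendsto (fun u : ℝ ↦ Real.log (1 - 2 / (Real.exp u + 1))) atTop (𝓝 (Real.log 1)) :=
    (Real.continuousAt_log one_ne_zero).tendsto.comp hq
  rw [Real.log_one] at hlog
  have hE := tendsto_expIntegralE1_atTop
  have h := hlog.add hE
  rw [add_zero] at h
  refine h.congr' ?_
  filter_upwards [eventually_gt_atTop (0 : ℝ)] with u hu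
  have he1 : 0 < Real.exp u - 1 := by linarith [Real.one_lt_exp_iff.2 hu]
  have he2 : 0 < Real.exp u + 1 := by positivity
  rw [← Real.log_div he1.ne' he2.ne']
  congr 1
  field_simp
  ring

/-- The antiderivative tends to `−log 2 − γ` at `0⁺` (`E₁ = Ein − γ − log`, `(eᵗ − 1)/t → 1`).
[folklore] -/
private theorem tendsto_antideriv_zero :
    Tendsto (fun u : ℝ ↦ Real.log (Real.exp u - 1) - Real.log (Real.exp u + 1) + expIntegralE1 u)
      (𝓝[>] 0) (𝓝 (-Real.log 2 - Real.eulerMascheroniConstant)) := by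
  -- `(eᵘ − 1)/u → 1`
  have hslope : Tendsto (fun u : ℝ ↦ (Real.exp u - 1) / u) (𝓝[>] 0) (𝓝 1) := by
    have h := (Real.hasDerivAt_exp 0).tendsto_slope_zero_right
    simp only [zero_add, Real.exp_zero, smul_eq_mul] at h
    refine h.congr' (Eventually.of_forall fun u ↦ ?_)
    show u⁻¹ * (Real.exp u - 1) = (Real.exp u - 1) / u
    rw [inv_mul_eq_div]
  have hlog1 : Tendsto (fun u : ℝ ↦ Real.log ((Real.exp u - 1) / u)) (𝓝[>] 0) (𝓝 (Real.log 1)) :=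
    (Real.continuousAt_log one_ne_zero).tendsto.comp hslope
  rw [Real.log_one] at hlog1
  have hlog2 : Tendsto (fun u : ℝ ↦ Real.log (Real.exp u + 1)) (𝓝[>] 0) (𝓝 (Real.log 2)) := by
    have hc : Tendsto (fun u : ℝ ↦ Real.exp u + 1) (𝓝 0) (𝓝 (Real.exp 0 + 1)) :=
      (Real.continuous_exp.tendsto 0).add tendsto_const_nhds
    rw [Real.exp_zero, show (1 : ℝ) + 1 = 2 by norm_num] at hc
    exact ((Real.continuousAt_log two_ne_zero).tendsto.comp hc).mono_left nhdsWithin_le_nhds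
  have hein : Tendsto ein (𝓝[>] 0) (𝓝 0) := by
    have h0 : Tendsto ein (𝓝[>] 0) (𝓝 (ein 0)) := (continuous_ein.tendsto 0).mono_left nhdsWithin_le_nhds
    rwa [ein_zero] at h0
  have h := ((hlog1.sub hlog2).add hein).sub (tendsto_const_nhds (x := Real.eulerMascheroniConstant))
  have e : (0 : ℝ) - Real.log 2 + 0 - Real.eulerMascheroniConstant =
      -Real.log 2 - Real.eulerMascheroniConstant := by ring
  rw [e] at h
  refine h.congr' ?_
  filter_upwards [self_mem_nhdsWithin] with u (hu : 0 < u)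
  have he1 : 0 < Real.exp u - 1 := by linarith [Real.one_lt_exp_iff.2 hu]
  rw [Real.log_div he1.ne' hu.ne', ein_eq_add hu]
  ring

/-! ### The evaluations -/

/-- **`∫₀^∞ (1/sinh t − e^{−t}/t) dt = γ + log 2`** (antiderivative `log((eᵗ−1)/(eᵗ+1)) + E₁(t)`,
Euler's integral `E₁ = Ein − γ − log`; this is the constant in Weil's evaluation of
`PF ∫ F K_{1,f}` against `Re ψ`, pp. 258–261).
[cite: Weil1952FormulesExplicites, pp. 258–261 ((5), (10): the constant of the archimedean term)] -/
theorem integral_inv_sinh_sub_exp_neg_div :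
    ∫ t in Ioi (0 : ℝ), (1 / Real.sinh t - Real.exp (-t) / t) =
      Real.eulerMascheroniConstant + Real.log 2 := by
  set f : ℝ → ℝ := fun t ↦ 1 / Real.sinh t - Real.exp (-t) / t with hf
  set Φ : ℝ → ℝ := fun u ↦ Real.log (Real.exp u - 1) - Real.log (Real.exp u + 1) + expIntegralE1 u
    with hΦ
  set L : ℝ := -Real.log 2 - Real.eulerMascheroniConstant with hL
  have hfi : IntegrableOn f (Ioi 0) := integrableOn_inv_sinh_sub_exp_neg_div
  -- the continuous extension of `Φ` to `[0, ∞)`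
  set Ψ : ℝ → ℝ := Function.update Φ 0 L with hΨ
  have hΨeq : ∀ u : ℝ, 0 < u → Ψ u = Φ u := fun u hu ↦ by
    simp [hΨ, hu.ne']
  have hFTC : ∀ R : ℝ, 0 < R → ∫ t in (0 : ℝ)..R, f t = Φ R - L := by
    intro R hR
    have hcont : ContinuousOn Ψ (Icc 0 R) := by
      intro x hx
      rcases eq_or_lt_of_le hx.1 with h0 | h0
      · -- at `0`
        rw [← h0]
        refine (continuousWithinAt_update_same).2 ?_
        exact tendsto_antideriv_zero.mono_left (nhdsWithin_mono _ fun y hy ↦ by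
          rcases hy with ⟨hy1, hy2⟩
          exact lt_of_le_of_ne hy1.1 (Ne.symm hy2))
      · -- at `x > 0`: `Ψ = Φ` near `x`, `Φ` differentiable
        have hd := (hasDerivAt_antideriv h0).continuousAt
        refine (hd.continuousWithinAt.congr_of_eventuallyEq ?_ (hΨeq x h0))
        filter_upwards [mem_nhdsWithin_of_mem_nhds (Ioi_mem_nhds h0)] with y hy using hΨeq y hy
    have hderiv : ∀ x ∈ Ioo 0 R, HasDerivAt Ψ (f x) x := by
      intro x hx
      refine (hasDerivAt_antideriv hx.1).congr_of_eventuallyEq ?_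
      filter_upwards [Ioi_mem_nhds hx.1] with y hy using hΨeq y hy
    have hint : IntervalIntegrable f volume 0 R := by
      refine (intervalIntegrable_iff_integrableOn_Ioc_of_le hR.le).2 ?_
      exact hfi.mono_set Ioc_subset_Ioi_self
    have h := intervalIntegral.integral_eq_sub_of_hasDerivAt_of_le hR.le hcont hderiv hint
    rw [h, hΨeq R hR]
    simp [hΨ]
  -- `R → ∞`
  have h1 : Tendsto (fun R : ℝ ↦ ∫ t in (0 : ℝ)..R, f t) atTop (𝓝 (∫ t in Ioi 0, f t)) :=
    intervalIntegral_tendsto_integral_Ioi 0 hfi tendsto_id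
  have h2 : Tendsto (fun R : ℝ ↦ ∫ t in (0 : ℝ)..R, f t) atTop (𝓝 (0 - L)) := by
    refine (tendsto_antideriv_atTop.sub tendsto_const_nhds).congr' ?_
    filter_upwards [eventually_gt_atTop (0 : ℝ)] with R hR
    exact (hFTC R hR).symm
  have := tendsto_nhds_unique h1 h2
  rw [this, hL]
  ring

/-- The real exponential Frullani kernel is integrable on `(0, ∞)` (`a, b > 0`). [folklore] -/
private theorem integrableOn_frullani_real {a b : ℝ} (ha : 0 < a) (hb : 0 < b) :
    IntegrableOn (fun t : ℝ ↦ (Real.exp (-(a * t)) - Real.exp (-(b * t))) / t) (Ioi 0) := by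
  have h0 : IntegrableOn (frullaniKernel (a : ℂ) (b : ℂ)) (Ioi 0) :=
    integrableOn_frullaniKernel (by simpa using ha) (by simpa using hb)
  have h1 : IntegrableOn (fun t : ℝ ↦ (frullaniKernel (a : ℂ) (b : ℂ) t).re) (Ioi 0) := h0.re
  refine h1.congr_fun (fun t _ ↦ ?_) measurableSet_Ioi
  have e : frullaniKernel (a : ℂ) (b : ℂ) t =
      (((Real.exp (-(a * t)) - Real.exp (-(b * t))) / t : ℝ) : ℂ) := by
    simp only [frullaniKernel, Complex.ofReal_div, Complex.ofReal_sub, Complex.ofReal_exp,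
      Complex.ofReal_neg, Complex.ofReal_mul]
  simp only [e, Complex.ofReal_re]

/-- **Integrability for general `β > 0`**: `1/sinh t − e^{−βt}/t` is integrable on `(0, ∞)`.
[cite: Weil1952FormulesExplicites, pp. 260–261 (the PF against K_{1,f} is a convergent integral)] -/
theorem integrableOn_inv_sinh_sub_exp_neg_mul_div {β : ℝ} (hβ : 0 < β) :
    IntegrableOn (fun t : ℝ ↦ 1 / Real.sinh t - Real.exp (-(β * t)) / t) (Ioi 0) := by
  have h := integrableOn_inv_sinh_sub_exp_neg_div.add (integrableOn_frullani_real one_pos hβ)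
  refine h.congr_fun (fun t (ht : 0 < t) ↦ ?_) measurableSet_Ioi
  simp only [Pi.add_apply, one_mul]
  ring

/-- **`∫₀^∞ (1/sinh t − e^{−βt}/t) dt = γ + log 2 + log β`** for `β > 0` (the case `β = 1` and the
exponential Frullani integral `∫₀^∞ (e^{−t} − e^{−βt}) dt/t = log β`).
[cite: Weil1952FormulesExplicites, pp. 258–261 ((5), (10): the constant of the archimedean term)] -/
theorem integral_inv_sinh_sub_exp_neg_mul_div {β : ℝ} (hβ : 0 < β) :
    ∫ t in Ioi (0 : ℝ), (1 / Real.sinh t - Real.exp (-(β * t)) / t) =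
      Real.eulerMascheroniConstant + Real.log 2 + Real.log β := by
  have hi1 := integrableOn_inv_sinh_sub_exp_neg_div
  have hi2 := integrableOn_frullani_real one_pos hβ
  have hF := integral_frullani_exp one_pos hβ
  rw [div_one] at hF
  have e : ∀ t : ℝ, 1 / Real.sinh t - Real.exp (-(β * t)) / t =
      (1 / Real.sinh t - Real.exp (-t) / t) + (Real.exp (-(1 * t)) - Real.exp (-(β * t))) / t := by
    intro t; rw [one_mul]; ring
  simp_rw [e]
  rw [integral_add hi1 hi2, integral_inv_sinh_sub_exp_neg_div, hF]

end Literature.Analysis.SpecialFunctions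

end
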